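import Summits.Ventures.CertifiedManyBodySolver.Theses.CovHg1201M19b
import Summits.Ventures.CertifiedManyBodySolver.Downfold.BoxesHg1201EKinematicCoverN
import HarnessLib

/-!
# Theorems/CovHg1201M19bKinematicParts.lean — route «CovHg1201M19b» (hubbard-cov-hg1201-1): the densities `n ≤ 179/200` of BOTH cruxes are
# certificate-free (state-free kinematics), and each crux follows from its high-density STRIP `n ∈ [179/200, 183/200]`

Supports stmt-Ventures-26186 «PatchLeftEdge» and stmt-Ventures-26187 «PatchBottom» (captain ASK «S3-BY-VALUE» 2026-08-28T06:58:36Z: the density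
direction is mostly kinematic — cut it by value). With the `M = 512` kernel row `B(−27/50, 3863/8192) ≤ 0.3052646019` (reading `0.5162867 ≤ 0.5166800` at
`n = 179/200`) and the state-free orbit-lower family lemma (`Downfold.hg1201M19b_patchSlot_orbitMean_ge_negBar`: every slot `σ ∈ [−27/50, −13/25]`, every
label, every source Hamiltonian, every density `x ∈ [87/100, 179/200]`), the bundles' inequality `−0.5166800 ≤ |D₄|⁻¹ Σ_γ Re ω_γ(−X₀(σ, ·))` holds with NO
ground-state certificate for `n ≤ 179/200`; the cruxes are therefore equivalent in content to their STRIPS `n ∈ [179/200, 183/200]`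
(`…_of_highDensityStrip`). Seat hubbard-cov-hg1201-box-2 (`prover-hubbard-cov-hg1201-box-2-0`).
HONEST FRAMING: state-free one-body kinematics + set algebra; nothing interaction-sensitive is certified here; the cruxes stay OPEN on their strips;
certified stiffness CEILINGS on a downfolded box = CONTROL / CALIBRATION + labelled heuristic (xx1); not a `T_c` or phase statement.
-/

namespace Summit.Ventures.CertifiedManyBodySolver.Theorems

open Set Filter Topology
open Summit.Ventures.CertifiedManyBodySolver.Theses.CovHg1201M19b
open Summit.Ventures.CertifiedManyBodySolver.Observables
open Summit.Ventures.CertifiedManyBodySolver.Downfold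
open Literature.MathematicalPhysics.QuantumLattice Literature.MathematicalPhysics.QuantumLattice.ThermodynamicLimit
open Literature.Probability.LatticeModels
open Matrix HubbardWave0
open scoped BigOperators ComplexOrder

/-- **The `n ≤ 179/200` part of «PatchLeftEdge» (stmt-Ventures-26186) holds state-free**: same binders as the item with the density range cut to
`[87/100, 179/200]`; no certificate. [cite: LiebLoss1993, §8, Theorem 8.2] [cite: HazraVermaRanderia2019, eqs. (2)-(6)] -/
theorem covHg1201M19b_patchLeftEdge_lowDensity_kinematic :
    ∀ n ∈ Set.Icc (87 / 100 : ℝ) (179 / 200), ∀ σ ∈ Set.Icc (-27 / 50 : ℝ) (-13 / 25), ∀ U' ∈ Set.Icc (7 / 2 : ℝ) (44 / 5),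
      ∀ (ω : InfVolFermionState 2) (Ls : ℕ → ℕ) (ψ : ∀ L, Fock (Orb (FermionTorus 2 L))),
      Tendsto Ls atTop atTop →
      (∀ j, IsGroundStateInSector (hubbardTorusTT' (Ls j) 1 (-27 / 50) U') (rectN n (Ls j)) 0 (ψ (Ls j))) →
      (∀ j, star (ψ (Ls j)) ⬝ᵥ ψ (Ls j) = 1) → ω.IsTorusLimitOf ψ Ls →
      -(5166800 / 10000000 : ℝ) ≤ ((Finset.univ : Finset (DihedralGroup 4)).card : ℝ)⁻¹ * ∑ g ∈ (Finset.univ : Finset (DihedralGroup 4)),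
        (ω.expect (d4ShiftSet g 0 (Literature.Probability.LatticeModels.box 2 7))
          (fermionEmbed (PolySite.d4Emb g 0 (Literature.Probability.LatticeModels.box 2 7)) (-oddMomentObsTT σ U' 0))).re :=
  fun _ hn σ hσ U' _ ω Ls ψ hLs hψ h1 hω =>
    hg1201M19b_patchSlot_orbitMean_ge_negBar σ U' (-27 / 50) U' hσ hn ω Ls ψ hLs hψ h1 hω

/-- **The `n ≤ 179/200` part of «PatchBottom» (stmt-Ventures-26187) holds state-free** (any source `s`, in particular `s ∈ [−27/50, σ]`).
[cite: LiebLoss1993, §8, Theorem 8.2] [cite: HazraVermaRanderia2019, eqs. (2)-(6)] -/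
theorem covHg1201M19b_patchBottom_lowDensity_kinematic :
    ∀ n ∈ Set.Icc (87 / 100 : ℝ) (179 / 200), ∀ σ ∈ Set.Icc (-27 / 50 : ℝ) (-13 / 25), ∀ s ∈ Set.Icc (-27 / 50 : ℝ) σ,
      ∀ (ω : InfVolFermionState 2) (Ls : ℕ → ℕ) (ψ : ∀ L, Fock (Orb (FermionTorus 2 L))),
      Tendsto Ls atTop atTop →
      (∀ j, IsGroundStateInSector (hubbardTorusTT' (Ls j) 1 s (7 / 2)) (rectN n (Ls j)) 0 (ψ (Ls j))) →
      (∀ j, star (ψ (Ls j)) ⬝ᵥ ψ (Ls j) = 1) → ω.IsTorusLimitOf ψ Ls →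
      -(5166800 / 10000000 : ℝ) ≤ ((Finset.univ : Finset (DihedralGroup 4)).card : ℝ)⁻¹ * ∑ g ∈ (Finset.univ : Finset (DihedralGroup 4)),
        (ω.expect (d4ShiftSet g 0 (Literature.Probability.LatticeModels.box 2 7))
          (fermionEmbed (PolySite.d4Emb g 0 (Literature.Probability.LatticeModels.box 2 7)) (-oddMomentObsTT σ (7 / 2) 0))).re :=
  fun _ hn σ hσ s _ ω Ls ψ hLs hψ h1 hω =>
    hg1201M19b_patchSlot_orbitMean_ge_negBar σ (7 / 2) s (7 / 2) hσ hn ω Ls ψ hLs hψ h1 hω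

/-- **«PatchLeftEdge» from its high-density STRIP**: the item's statement restricted to `n ∈ [179/200, 183/200]` implies the item (the rest is the
state-free part above). CONDITIONAL on the strip. [cite: ScalapinoWhiteZhang1993, §II] [cite: HazraVermaRanderia2019, eqs. (2)-(6)] -/
theorem covHg1201M19b_PatchLeftEdge_of_highDensityStrip
    (h : ∀ n ∈ Set.Icc (179 / 200 : ℝ) (183 / 200), ∀ σ ∈ Set.Icc (-27 / 50 : ℝ) (-13 / 25), ∀ U' ∈ Set.Icc (7 / 2 : ℝ) (44 / 5),
      ∀ (ω : InfVolFermionState 2) (Ls : ℕ → ℕ) (ψ : ∀ L, Fock (Orb (FermionTorus 2 L))),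
      Tendsto Ls atTop atTop →
      (∀ j, IsGroundStateInSector (hubbardTorusTT' (Ls j) 1 (-27 / 50) U') (rectN n (Ls j)) 0 (ψ (Ls j))) →
      (∀ j, star (ψ (Ls j)) ⬝ᵥ ψ (Ls j) = 1) → ω.IsTorusLimitOf ψ Ls →
      -(5166800 / 10000000 : ℝ) ≤ ((Finset.univ : Finset (DihedralGroup 4)).card : ℝ)⁻¹ * ∑ g ∈ (Finset.univ : Finset (DihedralGroup 4)),
        (ω.expect (d4ShiftSet g 0 (Literature.Probability.LatticeModels.box 2 7))
          (fermionEmbed (PolySite.d4Emb g 0 (Literature.Probability.LatticeModels.box 2 7)) (-oddMomentObsTT σ U' 0))).re) :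
    PatchLeftEdge := by
  unfold PatchLeftEdge
  intro n hn σ hσ U' hU' ω Ls ψ hLs hψ h1 hω
  rcases le_or_gt n (179 / 200) with hle | hgt
  · exact covHg1201M19b_patchLeftEdge_lowDensity_kinematic n ⟨hn.1, hle⟩ σ hσ U' hU' ω Ls ψ hLs hψ h1 hω
  · exact h n ⟨hgt.le, hn.2⟩ σ hσ U' hU' ω Ls ψ hLs hψ h1 hω

/-- **«PatchBottom» from its high-density STRIP** `n ∈ [179/200, 183/200]`. CONDITIONAL on the strip. [cite: ScalapinoWhiteZhang1993, §II] [cite: HazraVermaRanderia2019, eqs. (2)-(6)] -/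
theorem covHg1201M19b_PatchBottom_of_highDensityStrip
    (h : ∀ n ∈ Set.Icc (179 / 200 : ℝ) (183 / 200), ∀ σ ∈ Set.Icc (-27 / 50 : ℝ) (-13 / 25), ∀ s ∈ Set.Icc (-27 / 50 : ℝ) σ,
      ∀ (ω : InfVolFermionState 2) (Ls : ℕ → ℕ) (ψ : ∀ L, Fock (Orb (FermionTorus 2 L))),
      Tendsto Ls atTop atTop →
      (∀ j, IsGroundStateInSector (hubbardTorusTT' (Ls j) 1 s (7 / 2)) (rectN n (Ls j)) 0 (ψ (Ls j))) →
      (∀ j, star (ψ (Ls j)) ⬝ᵥ ψ (Ls j) = 1) → ω.IsTorusLimitOf ψ Ls →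
      -(5166800 / 10000000 : ℝ) ≤ ((Finset.univ : Finset (DihedralGroup 4)).card : ℝ)⁻¹ * ∑ g ∈ (Finset.univ : Finset (DihedralGroup 4)),
        (ω.expect (d4ShiftSet g 0 (Literature.Probability.LatticeModels.box 2 7))
          (fermionEmbed (PolySite.d4Emb g 0 (Literature.Probability.LatticeModels.box 2 7)) (-oddMomentObsTT σ (7 / 2) 0))).re) :
    PatchBottom := by
  unfold PatchBottom
  intro n hn σ hσ s hs ω Ls ψ hLs hψ h1 hω
  rcases le_or_gt n (179 / 200) with hle | hgt
  · exact covHg1201M19b_patchBottom_lowDensity_kinematic n ⟨hn.1, hle⟩ σ hσ s hs ω Ls ψ hLs hψ h1 hω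
  · exact h n ⟨hgt.le, hn.2⟩ σ hσ s hs ω Ls ψ hLs hψ h1 hω

end Summit.Ventures.CertifiedManyBodySolver.Theorems
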